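import Mathlib

/-!
# The integral of a character over a group, and the two-torus period of a product character (support, seat p1)

Against a left-invariant probability measure on a group `T`, a homomorphism `ψ : T →* ℂ` integrates to `0` unless
it is trivial (`integral_monoidHom_eq_zero`: translate by `t₀` with `ψ t₀ ≠ 1`), and to `1` when it is trivial.
On a product `T₀ × T₁` with the product measure the integral of `ψ₀(t₀) ψ₁(t₁)` factors, so the «two-torus
period» `∫ ψ₀(t₀) ψ₁(t₁)` is non-zero IFF both `ψ₀` and `ψ₁` are trivial (`integral_prod_monoidHom_ne_zero_iff`).
This is the bookkeeping of «a one-dimensional representation `χ ∘ det` has a non-zero `(T_A, μ_A)`-period iff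
`χμ₀ = 1 = χμ₁` on the two factors of the torus» (with `ψ_i = χ μ_i`).

Nothing here is about any automorphic object. No continuity or integrability is assumed: the Bochner integral of a
non-integrable function is `0`, and the translation and factorisation identities hold regardless.
Blind lane: Mathlib only; no sorry; axioms ⊆ {propext, Classical.choice, Quot.sound}.
-/

namespace Summit.Ventures.HodgeRepro2.T7SupportCharacterIntegral

open MeasureTheory

section one

variable {T : Type*} [Group T] [MeasurableSpace T] [MeasurableMul T]
  (μ : Measure T) [μ.IsMulLeftInvariant]

/-- **a non-trivial character integrates to zero**: `∫ ψ dμ = 0` if `ψ t₀ ≠ 1` for some `t₀`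
(left-invariance: `∫ ψ(t₀ t) = ψ(t₀) ∫ ψ`). -/
theorem integral_monoidHom_eq_zero (ψ : T →* ℂ) (hψ : ∃ t₀, ψ t₀ ≠ 1) : ∫ t, ψ t ∂μ = 0 := by
  obtain ⟨t₀, ht₀⟩ := hψ
  have h1 : ∫ t, ψ (t₀ * t) ∂μ = ∫ t, ψ t ∂μ := integral_mul_left_eq_self (fun t => ψ t) t₀
  have h2 : ∫ t, ψ (t₀ * t) ∂μ = ψ t₀ * ∫ t, ψ t ∂μ := by
    simp_rw [map_mul]
    exact integral_const_mul _ _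
  have h3 : (ψ t₀ - 1) * ∫ t, ψ t ∂μ = 0 := by linear_combination h1 - h2
  rcases mul_eq_zero.1 h3 with h | h
  · exact absurd (sub_eq_zero.1 h) ht₀
  · exact h

omit [MeasurableMul T] [μ.IsMulLeftInvariant] in
/-- the trivial character integrates to `1` against a probability measure -/
theorem integral_monoidHom_eq_one [IsProbabilityMeasure μ] (ψ : T →* ℂ) (hψ : ∀ t, ψ t = 1) :
    ∫ t, ψ t ∂μ = 1 := by
  simp [hψ]

/-- `∫ ψ dμ ≠ 0` iff `ψ` is trivial (probability measure) -/
theorem integral_monoidHom_ne_zero_iff [IsProbabilityMeasure μ] (ψ : T →* ℂ) :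
    (∫ t, ψ t ∂μ ≠ 0) ↔ ∀ t, ψ t = 1 := by
  constructor
  · intro h
    by_contra hcon
    push Not at hcon
    exact h (integral_monoidHom_eq_zero μ ψ hcon)
  · intro h
    rw [integral_monoidHom_eq_one μ ψ h]
    exact one_ne_zero

end one

section two

variable {T₀ T₁ : Type*} [Group T₀] [MeasurableSpace T₀] [MeasurableMul T₀]
  [Group T₁] [MeasurableSpace T₁] [MeasurableMul T₁]
  (μ₀ : Measure T₀) [μ₀.IsMulLeftInvariant] [IsProbabilityMeasure μ₀]
  (μ₁ : Measure T₁) [μ₁.IsMulLeftInvariant] [IsProbabilityMeasure μ₁]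

omit [MeasurableMul T₀] [MeasurableMul T₁] [μ₀.IsMulLeftInvariant] [μ₁.IsMulLeftInvariant] in
/-- the two-torus period of a product character factors -/
theorem integral_prod_monoidHom (ψ₀ : T₀ →* ℂ) (ψ₁ : T₁ →* ℂ) :
    ∫ t, ψ₀ t.1 * ψ₁ t.2 ∂(μ₀.prod μ₁) = (∫ t, ψ₀ t ∂μ₀) * ∫ t, ψ₁ t ∂μ₁ :=
  integral_prod_mul _ _

/-- **the two-torus period of a product character is non-zero iff both factors are trivial** -/
theorem integral_prod_monoidHom_ne_zero_iff (ψ₀ : T₀ →* ℂ) (ψ₁ : T₁ →* ℂ) :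
    (∫ t, ψ₀ t.1 * ψ₁ t.2 ∂(μ₀.prod μ₁) ≠ 0) ↔ (∀ t, ψ₀ t = 1) ∧ (∀ t, ψ₁ t = 1) := by
  rw [integral_prod_monoidHom, mul_ne_zero_iff, integral_monoidHom_ne_zero_iff,
    integral_monoidHom_ne_zero_iff]

end two

end Summit.Ventures.HodgeRepro2.T7SupportCharacterIntegral
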